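import Summits.ABC.IUTFork.Joshi.AnabelomorphyFiniteness
import Summits.ABC.IUTFork.Joshi.RosettaIndeterminaciesProofs
import Literature.IUT.LogVolume.PadicSubfields
import Literature.IUT.LogVolume.LocalDegreeGlobalBounds
import Literature.AnabelianGeometry.AbsoluteAnabelian.MLFGaloisTypeProofs
import HarnessLib

/-!
# Joshi, *Arithmetic Teichmüller Spaces III* (arXiv:2401.13508v4) §8.11.2, the (Ind1) sentence «for each prime v» —
# DECIDED at real objects: the anabelomorphs of `ℚ_p` (and of every degree/residue-rigid `E ⊆ Q̄_p`) are `{E}`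

Proof-only companion of the abc-iut cell, branch E «type Joshi's construction, test vs S» (rung LADDER-ABC:A2.E; seat
abc-iut-E-t18, slot T-18 = [J-III] §8.9–8.11; parents `Joshi/AnabelomorphyFiniteness.lean` (Prop. 8.11.1.1 over Mathlib
objects, PROVED), `Joshi/RosettaIndeterminacies.lean` (the §8.11 signature `RosettaIndDatum`, the typed sentences
`CanonicalInd1` / `CanonicalInd1Weak` / `JoshiThreeInd`) and `Joshi/RosettaIndeterminaciesProofs.lean`). **No side is taken** on
[IUTchIII] Cor. 3.12, on Joshi's claims, or on Mochizuki's report on them; typed ≠ proved ≠ endorsed; NOT S-bearing (a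
Joshi-internal precision item: it changes no word of the cell's census of `S = Cor312Vol.PilotKummerIndRelated`).

THE PRINTED SENTENCE ([J-III] §8.11.2, render p.93 l.13–19): «Anabelomorphy at all primes or Mochizuki's Ind1: This arises from
the fact that the isomorphism class of G_{L_v} (for each prime v) does not uniquely determine L_v in its isomorphism class …
[Joshi 2020b].» The lineage typed it AS PRINTED, with the universal quantifier «for each prime v», as
`RosettaIndDatum.CanonicalInd1 := ∀ v, ∃ E′ ∈ JInd1 v, ¬ fiso v (base v) E′` and flagged in the docstring (l.280–288 of the parent)
that this ∀-form is STRONGER than the classical fact: strictly anabelomorphic `p`-adic fields exist for SOME fields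
([Jarden–Ritter 1979, J. Number Theory 11, 1–13]; [Joshi 2020b] = arXiv:2008.01228, lit text chunk p0005 L30–36: `ℚ_p(ζ_p, p^{1/p})` vs
`ℚ_p(ζ_p, (1+p)^{1/p})` for `p > 2`), not for all — the ∃-form is `CanonicalInd1Weak`. This file makes the flag KERNEL:

* §1 (REAL OBJECTS `ℚ_p ⊆ E ⊆ Q̄_p = PadicAlgCl p`, `Anabelomorphic` of the parent): the anabelomorphs of finite degree of
  `ℚ_p = ⊥` are exactly `{⊥}` (`anabelomorphs_bot`), by the amphoricity of the degree — [AbsAnab] Prop. 1.2.1 (v), the cell's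
  FACT-LIST fact F-0022 `galoisMLF_iso_degrees`, a THEOREM of the tree (`galoisMLF_iso_degrees_holds`) — and Mathlib's
  `IntermediateField.finrank_eq_one_iff`; more generally (`anabelomorphs_eq_singleton_of_rigid`) the anabelomorphs of any `E`
  that is the ONLY subfield of `Q̄_p` with its degree and its residue cardinality (binder `hrigid`; when `E/ℚ_p` is unramified
  this is the classical uniqueness of the unramified extension of a given degree — [Joshi 2020b] lit text chunk p0004 L32 «there is a unique
  unramified extension of ℚ_p of a given degree and … the degree of the maximal unramified subextensions is amphoric» — which
  the tree does not hold, hence a binder, discharged here at degree 1: `rigid_bot`) are exactly `{E}`, by F-0022's second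
  clause (residue cardinality amphoric).
* §2 (SIGNATURE): a place whose Ind1-range is `fiso`-trivial refutes `CanonicalInd1`; if every place is such, also
  `CanonicalInd1Weak` and the bookkeeping conjunction `JoshiThreeInd` fail AS TYPED.
* §3 (BRIDGE): for ANY `𝔍 : RosettaIndDatum` and any place `v` whose Ind1 coordinates (`Fld v`, `base v`, `anab v`, `fiso v`)
  are READ on the real objects with `L_v = ℚ_p` (a reading map `ι` into the subfields of `Q̄_p` of finite degree, `ι (base v) = ⊥`,
  `anab ⇒ Anabelomorphic`, `ι E′ = ι (base v) ⇒ fiso`), the Ind1-range at `v` is `fiso`-trivial and `¬ 𝔍.CanonicalInd1`.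

CONSEQUENCE FOR THE E3 DICTIONARY (prose; nothing about S is proved or changed): at every place `v` of `L` with `L_v = ℚ_{p_v}`
— and, modulo the classical uniqueness of unramified extensions, at every unramified place — Joshi's (Ind1) «consider all
Fargues–Fontaine curves X with π₁^{et}(X) = G_{L_v}» (p.92 l.18–23) ranges over the single field `L_v`: it supplies NO move
there, so any S-bearing transport at such a place rests on his (Ind2) alone (the cell's located attach point A1 / census row
Y-12 — unchanged). [claim: Joshi2024ATS3, status: disputed]; inputs [cite: MochizukiAbsAnab2004, Prop 1.2.1 (v) p.10].
Standard axioms only; 0 `def`, 0 `instance`, 0 `sorry`, no new `Prop` fact.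

## v2 (appended, same seat/generation): the rigidity binder DISCHARGED at every absolutely UNRAMIFIED place

§1b proves `hrigid` outright for every absolutely unramified `E ⊆ Q̄_p` (`f_E = [E : ℚ_p]`, equivalently `e_E = 1`):
`eq_of_unramified` — such an `E` is the ONLY subfield of `Q̄_p` of finite degree with its degree and residue degree — via
Teichmüller (a finite `E ⊆ Q̄_p` contains a primitive `(p^{f_E} − 1)`-th root of unity `ζ`: the tree's
`Literature.IUT.LogVolume.card_rootsOfUnity_residueCard_sub_one` + Mathlib's `card_rootsOfUnity_eq_iff_exists_isPrimitiveRoot`;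
[Neukirch, ANT, Ch. II Prop. (5.3)] `K* = (π) × μ_{q−1} × U^{(1)}`), the bound `f ≤ f_U ≤ [U : ℚ_p]` for any `U ∋ ζ` (the tree's
`primeToRootsOfUnity_eq_image_rootsOfUnity`, `residueDegree_le_finrank`), and `U := ℚ_p(ζ) ≤ E ∩ E′` with `[E : ℚ_p] = f ≤ [U : ℚ_p]`
⇒ `E = U = E′` (cf. [Neukirch, ANT, Ch. II Prop. (7.12) (i)]: `ℚ_p(ζ_{p^f−1})` is the unramified extension of degree `f`). Hence
**`anabelomorphs_eq_singleton_of_unramified`: an absolutely unramified `E ⊆ Q̄_p` is determined, among the subfields of finite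
degree, by its absolute Galois group** (F-0022 both clauses + `eq_of_unramified`), and (§3b) `CanonicalInd1` fails AS TYPED at every
datum with a place read on the real objects with `L_v/ℚ_{p_v}` unramified — for a number field `L`, all but finitely many places
(remark, not used): Joshi's (Ind1) supplies NO move at any unramified place. Inputs BY NAME: F-0022 (`galoisMLF_iso_degrees_holds`),
the tree's [IUTchIV] §1 normed model of `E ⊆ Q̄_p` (`Literature.IUT.LogVolume.PadicSubfields`, scoped `ProperSpace`) and
`residueCardMLF_eq_pow_residueDegree` ([AbsTopIII] Prop 5.8 (i) recipe). Still 0 `def`, 0 new `Prop`, standard axioms; NOT S-bearing.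
[cite: NeukirchANT1999, Ch. II Prop. (5.3)] [cite: NeukirchANT1999, Ch. II Prop. (7.12) (i)]
-/

noncomputable section

namespace Summit.ABC.IUTFork.Joshi.ATS3

open Literature.AnabelianGeometry.AbsoluteAnabelian

/-! ## 1. Real objects: anabelomorphs of `ℚ_p`, and of a degree/residue-rigid subfield of `Q̄_p` -/

section RealObjects

variable (p : ℕ) [Fact p.Prime]

/-- Anabelomorphic subfields of `Q̄_p` of finite degree have the same residue cardinality (second clause of [AbsAnab]
Prop. 1.2.1 (v) «[k₁ : 𝔽_p] = [k₂ : 𝔽_p]», F-0022 `galoisMLF_iso_degrees`, a theorem of the tree; companion of the parent's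
`finrank_eq_of_anabelomorphic`). [cite: MochizukiAbsAnab2004, Prop 1.2.1 (v) p.10] -/
theorem residueCardMLF_eq_of_anabelomorphic (E E' : IntermediateField ℚ_[p] (PadicAlgCl p))
    [FiniteDimensional ℚ_[p] E] [FiniteDimensional ℚ_[p] E'] (h : Anabelomorphic p E E') :
    residueCardMLF p E = residueCardMLF p E' :=
  (galoisMLF_iso_degrees_holds p p E E' h).2

/-- **A subfield of `Q̄_p` of finite degree anabelomorphic to `ℚ_p` IS `ℚ_p`** (degree amphoric, F-0022, + a subfield of
degree `1` is `⊥`). [cite: MochizukiAbsAnab2004, Prop 1.2.1 (v) p.10] -/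
theorem eq_bot_of_anabelomorphic_bot (E' : IntermediateField ℚ_[p] (PadicAlgCl p)) [FiniteDimensional ℚ_[p] E']
    (h : Anabelomorphic p ⊥ E') : E' = ⊥ := by
  have h1 : Module.finrank ℚ_[p] E' = 1 := by
    rw [← finrank_eq_of_anabelomorphic p ⊥ E' h, IntermediateField.finrank_bot]
  exact IntermediateField.finrank_eq_one_iff.1 h1

/-- For a subfield of `Q̄_p` of finite degree: anabelomorphic to `ℚ_p` iff equal to `ℚ_p`.
[cite: MochizukiAbsAnab2004, Prop 1.2.1 (v) p.10] -/
theorem anabelomorphic_bot_iff (E' : IntermediateField ℚ_[p] (PadicAlgCl p)) [FiniteDimensional ℚ_[p] E'] :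
    Anabelomorphic p ⊥ E' ↔ E' = ⊥ := by
  refine ⟨eq_bot_of_anabelomorphic_bot p E', ?_⟩
  rintro rfl
  exact anabelomorphic_refl p ⊥

/-- **The anabelomorphs of `ℚ_p` inside `Q̄_p` are exactly `{ℚ_p}`**: the set of Prop. 8.11.1.1 (finite by the parent's
`finite_anabelomorphs`) is the singleton `{⊥}` at `E = ℚ_p`. Hence Joshi's (Ind1) «consider all … X with π₁^{et}(X) = G_{L_v}»
(p.92 l.18–23) ranges over ONE field at every place with `L_v = ℚ_{p_v}`. [cite: MochizukiAbsAnab2004, Prop 1.2.1 (v) p.10] -/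
theorem anabelomorphs_bot :
    {E' : IntermediateField ℚ_[p] (PadicAlgCl p) | FiniteDimensional ℚ_[p] E' ∧ Anabelomorphic p ⊥ E'} = {⊥} := by
  ext E'
  simp only [Set.mem_setOf_eq, Set.mem_singleton_iff]
  constructor
  · rintro ⟨hE', h⟩
    haveI : FiniteDimensional ℚ_[p] E' := hE'
    exact eq_bot_of_anabelomorphic_bot p E' h
  · rintro rfl
    exact ⟨inferInstance, anabelomorphic_refl p ⊥⟩

/-- **Anabelomorphs of a degree/residue-RIGID subfield.** If `E` is the only subfield of `Q̄_p` of finite degree with its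
degree `[E : ℚ_p]` and its residue cardinality `q_E` (binder `hrigid` — for `E/ℚ_p` unramified this is the classical
uniqueness of the unramified extension of a given degree, [Joshi 2020b] arXiv:2008.01228 lit text chunk p0004 L32, not held by the tree),
then its anabelomorphs of finite degree are exactly `{E}`: both invariants are amphoric ([AbsAnab] Prop. 1.2.1 (v), F-0022,
a theorem of the tree). [cite: MochizukiAbsAnab2004, Prop 1.2.1 (v) p.10] -/
theorem anabelomorphs_eq_singleton_of_rigid (E : IntermediateField ℚ_[p] (PadicAlgCl p)) [FiniteDimensional ℚ_[p] E]
    (hrigid : ∀ E' : IntermediateField ℚ_[p] (PadicAlgCl p), FiniteDimensional ℚ_[p] E' →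
      Module.finrank ℚ_[p] E' = Module.finrank ℚ_[p] E → residueCardMLF p E' = residueCardMLF p E → E' = E) :
    {E' : IntermediateField ℚ_[p] (PadicAlgCl p) | FiniteDimensional ℚ_[p] E' ∧ Anabelomorphic p E E'} = {E} := by
  ext E'
  simp only [Set.mem_setOf_eq, Set.mem_singleton_iff]
  constructor
  · rintro ⟨hE', h⟩
    haveI : FiniteDimensional ℚ_[p] E' := hE'
    exact hrigid E' hE' (finrank_eq_of_anabelomorphic p E E' h).symm (residueCardMLF_eq_of_anabelomorphic p E E' h).symm
  · intro hE'
    subst hE'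
    exact ⟨inferInstance, anabelomorphic_refl p _⟩

/-- The rigidity binder is DISCHARGED at degree `1`: `ℚ_p = ⊥` is the only subfield of `Q̄_p` of degree `1` (whatever the
residue cardinality) — non-vacuity of `anabelomorphs_eq_singleton_of_rigid`. [folklore] -/
theorem rigid_bot (E' : IntermediateField ℚ_[p] (PadicAlgCl p)) (_hE' : FiniteDimensional ℚ_[p] E')
    (hdeg : Module.finrank ℚ_[p] E' = Module.finrank ℚ_[p] (⊥ : IntermediateField ℚ_[p] (PadicAlgCl p)))
    (_hq : residueCardMLF p E' = residueCardMLF p (⊥ : IntermediateField ℚ_[p] (PadicAlgCl p))) : E' = ⊥ := by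
  rw [IntermediateField.finrank_bot] at hdeg
  exact IntermediateField.finrank_eq_one_iff.1 hdeg

/-- `anabelomorphs_bot` recovered from the rigid form (consistency of §1). [cite: MochizukiAbsAnab2004, Prop 1.2.1 (v) p.10] -/
theorem anabelomorphs_bot' :
    {E' : IntermediateField ℚ_[p] (PadicAlgCl p) | FiniteDimensional ℚ_[p] E' ∧ Anabelomorphic p ⊥ E'} = {⊥} :=
  anabelomorphs_eq_singleton_of_rigid p ⊥ (rigid_bot p)

end RealObjects

/-! ## 2. Over the §8.11 signature: a `fiso`-trivial Ind1-range refutes the ∀-form -/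

namespace RosettaIndDatum

variable (𝔍 : RosettaIndDatum)

/-- **A place whose Ind1-range is `fiso`-trivial refutes the typed ∀-form `CanonicalInd1`** («for each prime v … does not
uniquely determine L_v», p.93 l.13–19, typed l.287 of the parent): if every anabelomorph of `L_v` at SOME place `v` is
isomorphic to `L_v`, the sentence fails as typed. Pure logic over the signature. [claim: Joshi2024ATS3, status: disputed] -/
theorem not_canonicalInd1_of_rigid_place {v : 𝔍.V} (h : ∀ E' ∈ 𝔍.JInd1 v, 𝔍.fiso v (𝔍.base v) E') :
    ¬ 𝔍.CanonicalInd1 := fun hc => by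
  obtain ⟨E', hE', hne⟩ := hc v
  exact hne (h E' hE')

/-- If EVERY place has a `fiso`-trivial Ind1-range, the ∃-form `CanonicalInd1Weak` fails too (e.g. a datum all of whose
places have `L_v = ℚ_{p_v}`). Pure logic. [claim: Joshi2024ATS3, status: disputed] -/
theorem not_canonicalInd1Weak_of_rigid (h : ∀ (v : 𝔍.V), ∀ E' ∈ 𝔍.JInd1 v, 𝔍.fiso v (𝔍.base v) E') :
    ¬ 𝔍.CanonicalInd1Weak := fun ⟨v, E', hE', hne⟩ => hne (h v E' hE')

/-- The bookkeeping conjunction `JoshiThreeInd` (§8.11.1 «Mochizuki's Three Indeterminacies … are necessarily consequences of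
the existence of Arithmetic Teichmuller Spaces», typed as `CanonicalInd3 ∧ CanonicalInd2 ∧ CanonicalInd1`) fails AS TYPED at
any datum with a `fiso`-rigid place — through its third conjunct only; nothing is said about Ind2/Ind3.
[claim: Joshi2024ATS3, status: disputed] -/
theorem not_joshiThreeInd_of_rigid_place {v : 𝔍.V} (h : ∀ E' ∈ 𝔍.JInd1 v, 𝔍.fiso v (𝔍.base v) E') :
    ¬ 𝔍.JoshiThreeInd := fun h3 => 𝔍.not_canonicalInd1_of_rigid_place h h3.2.2

/-- Conversely the typed ∀-form forces a NON-rigid Ind1-range at every place (contrapositive bookkeeping; cf. the parent's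
`nontrivial_jInd1_of_canonicalInd1`). [claim: Joshi2024ATS3, status: disputed] -/
theorem exists_not_fiso_of_canonicalInd1 (h : 𝔍.CanonicalInd1) (v : 𝔍.V) :
    ∃ E' ∈ 𝔍.JInd1 v, ¬ 𝔍.fiso v (𝔍.base v) E' := h v

/-! ## 3. Bridge: a place of the signature READ on the real objects with `L_v = ℚ_p` -/

/-- **Reading a place on the real objects.** Let `v` be a place of a §8.11 datum `𝔍` whose Ind1 coordinates are read into the
subfields of `Q̄_p` of finite degree by a map `ι` with `ι (base v) = ⊥` (i.e. `L_v = ℚ_p`), `anab v (base v) E′ ⇒` the real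
`Anabelomorphic p`, and `ι E′ = ι (base v) ⇒ fiso v (base v) E′` (fields read to the same subfield count as isomorphic). Then
every anabelomorph of `L_v` is `fiso`-related to it: the Ind1-range at `v` is RIGID. [cite: MochizukiAbsAnab2004, Prop 1.2.1 (v) p.10] -/
theorem jInd1_rigid_of_read_bot {v : 𝔍.V} (p : ℕ) [Fact p.Prime]
    (ι : 𝔍.Fld v → IntermediateField ℚ_[p] (PadicAlgCl p)) (hfin : ∀ E', FiniteDimensional ℚ_[p] (ι E'))
    (hbase : ι (𝔍.base v) = ⊥)
    (hanab : ∀ E', 𝔍.anab v (𝔍.base v) E' → Anabelomorphic p (ι (𝔍.base v)) (ι E'))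
    (hfiso : ∀ E', ι E' = ι (𝔍.base v) → 𝔍.fiso v (𝔍.base v) E') :
    ∀ E' ∈ 𝔍.JInd1 v, 𝔍.fiso v (𝔍.base v) E' := by
  intro E' hE'
  haveI : FiniteDimensional ℚ_[p] (ι E') := hfin E'
  have hα : Anabelomorphic p ⊥ (ι E') := hbase ▸ hanab E' hE'
  exact hfiso E' ((eq_bot_of_anabelomorphic_bot p (ι E') hα).trans hbase.symm)

/-- **[J-III] §8.11.2's (Ind1) sentence, ∀-form, is FALSE AS TYPED at every datum with a place read on the real objects with
`L_v = ℚ_p`.** (Such places exist for every number field `L` — the primes split completely in `L` — a remark, not used.)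
The ∃-form `CanonicalInd1Weak` is the classical Jarden–Ritter phenomenon and is NOT touched. Not S-bearing.
[cite: MochizukiAbsAnab2004, Prop 1.2.1 (v) p.10] -/
theorem not_canonicalInd1_of_read_bot {v : 𝔍.V} (p : ℕ) [Fact p.Prime]
    (ι : 𝔍.Fld v → IntermediateField ℚ_[p] (PadicAlgCl p)) (hfin : ∀ E', FiniteDimensional ℚ_[p] (ι E'))
    (hbase : ι (𝔍.base v) = ⊥)
    (hanab : ∀ E', 𝔍.anab v (𝔍.base v) E' → Anabelomorphic p (ι (𝔍.base v)) (ι E'))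
    (hfiso : ∀ E', ι E' = ι (𝔍.base v) → 𝔍.fiso v (𝔍.base v) E') :
    ¬ 𝔍.CanonicalInd1 :=
  𝔍.not_canonicalInd1_of_rigid_place (𝔍.jInd1_rigid_of_read_bot p ι hfin hbase hanab hfiso)

/-- The same at a degree/residue-RIGID place `L_v = E` (binder `hrigid` of §1; unramified places modulo the classical
uniqueness of unramified extensions): the Ind1-range at `v` is rigid and `CanonicalInd1` fails as typed.
[cite: MochizukiAbsAnab2004, Prop 1.2.1 (v) p.10] -/
theorem not_canonicalInd1_of_read_rigid {v : 𝔍.V} (p : ℕ) [Fact p.Prime]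
    (ι : 𝔍.Fld v → IntermediateField ℚ_[p] (PadicAlgCl p)) (hfin : ∀ E', FiniteDimensional ℚ_[p] (ι E'))
    (hrigid : ∀ E' : IntermediateField ℚ_[p] (PadicAlgCl p), FiniteDimensional ℚ_[p] E' →
      Module.finrank ℚ_[p] E' = Module.finrank ℚ_[p] (ι (𝔍.base v)) →
        residueCardMLF p E' = residueCardMLF p (ι (𝔍.base v)) → E' = ι (𝔍.base v))
    (hanab : ∀ E', 𝔍.anab v (𝔍.base v) E' → Anabelomorphic p (ι (𝔍.base v)) (ι E'))
    (hfiso : ∀ E', ι E' = ι (𝔍.base v) → 𝔍.fiso v (𝔍.base v) E') :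
    ¬ 𝔍.CanonicalInd1 := by
  haveI : FiniteDimensional ℚ_[p] (ι (𝔍.base v)) := hfin _
  refine 𝔍.not_canonicalInd1_of_rigid_place (v := v) fun E' hE' => hfiso E' ?_
  haveI : FiniteDimensional ℚ_[p] (ι E') := hfin E'
  have hmem : ι E' ∈ {E'' : IntermediateField ℚ_[p] (PadicAlgCl p) |
      FiniteDimensional ℚ_[p] E'' ∧ Anabelomorphic p (ι (𝔍.base v)) E''} := ⟨hfin E', hanab E' hE'⟩
  rw [anabelomorphs_eq_singleton_of_rigid p (ι (𝔍.base v)) hrigid] at hmem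
  exact hmem

end RosettaIndDatum

/-! ## 1b (v2, appended). The rigidity binder DISCHARGED at absolutely unramified `E ⊆ Q̄_p` -/

open Literature.IUT.LogVolume (residueDegree residueDegree_pos residueDegree_le_finrank
  card_rootsOfUnity_residueCard_sub_one residueCard_sub_one_ne_zero absRamificationIdx
  absRamificationIdx_mul_residueDegree)
open scoped Literature.IUT.LogVolume

section Unramified

variable (p : ℕ) [Fact p.Prime]

/-- **Teichmüller: a finite `E ⊆ Q̄_p` contains a primitive `(q_E − 1)`-th root of unity**, `q_E = p^{f_E}`
(from the tree's `card_rootsOfUnity_residueCard_sub_one` and cyclicity of the roots of unity of a field).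
[cite: NeukirchANT1999, Ch. II Prop. (5.3)] -/
theorem exists_mem_isPrimitiveRoot (E : IntermediateField ℚ_[p] (PadicAlgCl p)) [FiniteDimensional ℚ_[p] E] :
    ∃ ζ : PadicAlgCl p, ζ ∈ E ∧ IsPrimitiveRoot ζ (p ^ residueDegree p E - 1) := by
  haveI : NeZero (p ^ residueDegree p E - 1) := ⟨residueCard_sub_one_ne_zero p E⟩
  obtain ⟨ζ, hζ⟩ := (card_rootsOfUnity_eq_iff_exists_isPrimitiveRoot).1 (card_rootsOfUnity_residueCard_sub_one p E)
  exact ⟨ζ, ζ.2, IsPrimitiveRoot.coe_submonoidClass_iff.2 hζ⟩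

/-- The residue degree of a subfield containing a primitive `(p^f − 1)`-th root of unity is at least `f`
(`μ_{(p′)}(U) = μ_{q_U − 1}(U)`, the tree's `primeToRootsOfUnity_eq_image_rootsOfUnity`).
[cite: NeukirchANT1999, Ch. II Prop. (5.3)] -/
theorem le_residueDegree_of_isPrimitiveRoot_mem (U : IntermediateField ℚ_[p] (PadicAlgCl p)) [FiniteDimensional ℚ_[p] U]
    {f : ℕ} {ζ : PadicAlgCl p} (hζ : IsPrimitiveRoot ζ (p ^ f - 1)) (hf : 0 < f) (hmem : ζ ∈ U) :
    f ≤ residueDegree p U := by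
  have hp : p.Prime := Fact.out
  set ζU : U := ⟨ζ, hmem⟩ with hζU_def
  have hζU : IsPrimitiveRoot ζU (p ^ f - 1) := IsPrimitiveRoot.coe_submonoidClass_iff.1 (by exact hζ)
  have hq1 : 0 < p ^ f - 1 := by
    have : p ^ 1 ≤ p ^ f := Nat.pow_le_pow_right hp.pos hf
    have : 2 ≤ p ^ f := le_trans (by simpa using hp.two_le) this
    omega
  have hpq : ¬ p ∣ p ^ f - 1 := by
    intro h
    have hpp : p ∣ p ^ f := dvd_pow_self p hf.ne'
    have h1 : p ∣ p ^ f - (p ^ f - 1) := Nat.dvd_sub hpp h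
    rw [Nat.sub_sub_self (Nat.one_le_pow _ _ hp.pos)] at h1
    exact hp.one_lt.ne' (Nat.dvd_one.mp h1)
  have hmemμ : (ζU : U) ∈ primeToRootsOfUnity p U := ⟨p ^ f - 1, hq1, hpq, hζU.pow_eq_one⟩
  rw [primeToRootsOfUnity_eq_image_rootsOfUnity p U] at hmemμ
  obtain ⟨u, hu, huζ⟩ := hmemμ
  have hpow : ζU ^ (p ^ residueDegree p U - 1) = 1 := by
    rw [← huζ, ← Units.val_pow_eq_pow_val]
    rw [SetLike.mem_coe, mem_rootsOfUnity] at hu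
    rw [hu, Units.val_one]
  have hdvd : p ^ f - 1 ∣ p ^ residueDegree p U - 1 := hζU.dvd_of_pow_eq_one _ hpow
  have hle : p ^ f - 1 ≤ p ^ residueDegree p U - 1 :=
    Nat.le_of_dvd (Nat.sub_pos_of_lt (Nat.one_lt_pow (residueDegree_pos p U).ne' hp.one_lt)) hdvd
  have hle' : p ^ f ≤ p ^ residueDegree p U := by
    have := Nat.one_le_pow (residueDegree p U) p hp.pos
    have := Nat.one_le_pow f p hp.pos
    omega
  exact (Nat.pow_le_pow_iff_right hp.two_le).1 hle'

/-- **An absolutely unramified finite `E ⊆ Q̄_p` is the only subfield of `Q̄_p` with its degree and residue degree**: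
both `E` and any such `E′` equal `ℚ_p(ζ)` for a primitive `(p^f − 1)`-th root of unity `ζ` (uniqueness of the unramified
extension of a given degree, inside a fixed algebraic closure). [cite: NeukirchANT1999, Ch. II Prop. (7.12) (i)] -/
theorem eq_of_unramified (E E' : IntermediateField ℚ_[p] (PadicAlgCl p)) [FiniteDimensional ℚ_[p] E]
    [FiniteDimensional ℚ_[p] E'] (hE : residueDegree p E = Module.finrank ℚ_[p] E)
    (hdeg : Module.finrank ℚ_[p] E' = Module.finrank ℚ_[p] E) (hf : residueDegree p E' = residueDegree p E) :
    E' = E := by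
  set f := residueDegree p E with hf_def
  have hf0 : 0 < f := residueDegree_pos p E
  obtain ⟨ζ, hζE, hζ⟩ := exists_mem_isPrimitiveRoot p E
  obtain ⟨ζ', hζ'E', hζ'⟩ := exists_mem_isPrimitiveRoot p E'
  rw [hf] at hζ'
  -- ζ is a power of ζ', hence lies in E'
  haveI : NeZero (p ^ f - 1) := ⟨residueCard_sub_one_ne_zero p E⟩
  have hζE' : ζ ∈ E' := by
    obtain ⟨i, -, hi⟩ := hζ'.eq_pow_of_pow_eq_one hζ.pow_eq_one
    rw [← hi]
    exact pow_mem hζ'E' i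
  -- U = ℚ_p(ζ) sits in both, with [U : ℚ_p] ≥ f = [E : ℚ_p] = [E' : ℚ_p]
  set U : IntermediateField ℚ_[p] (PadicAlgCl p) := IntermediateField.adjoin ℚ_[p] {ζ} with hU
  have hUE : U ≤ E := IntermediateField.adjoin_simple_le_iff.2 hζE
  have hUE' : U ≤ E' := IntermediateField.adjoin_simple_le_iff.2 hζE'
  haveI : FiniteDimensional ℚ_[p] U :=
    Module.Finite.of_injective (IntermediateField.inclusion hUE).toLinearMap (IntermediateField.inclusion_injective hUE)
  have hζU : ζ ∈ U := IntermediateField.mem_adjoin_simple_self ℚ_[p] ζ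
  have hfU : f ≤ Module.finrank ℚ_[p] U :=
    (le_residueDegree_of_isPrimitiveRoot_mem p U hζ hf0 hζU).trans (residueDegree_le_finrank p U)
  have hUeqE : U = E := IntermediateField.eq_of_le_of_finrank_le hUE (by rw [← hE]; exact hfU)
  have hUeqE' : U = E' := IntermediateField.eq_of_le_of_finrank_le hUE' (by rw [hdeg, ← hE]; exact hfU)
  rw [← hUeqE', hUeqE]

/-- Equal residue cardinalities `q = p^f` give equal residue degrees. [folklore] -/
theorem residueDegree_eq_of_residueCardMLF_eq (E E' : IntermediateField ℚ_[p] (PadicAlgCl p))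
    [FiniteDimensional ℚ_[p] E] [FiniteDimensional ℚ_[p] E'] (h : residueCardMLF p E' = residueCardMLF p E) :
    residueDegree p E' = residueDegree p E := by
  rw [residueCardMLF_eq_pow_residueDegree, residueCardMLF_eq_pow_residueDegree] at h
  exact Nat.pow_right_injective (Fact.out : p.Prime).two_le h

/-- **The rigidity binder of `anabelomorphs_eq_singleton_of_rigid` DISCHARGED at every absolutely unramified `E`**
(`f_E = [E : ℚ_p]`): `E` is the only subfield of `Q̄_p` of finite degree with its degree and residue cardinality.
[cite: NeukirchANT1999, Ch. II Prop. (7.12) (i)] -/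
theorem rigid_of_unramified (E : IntermediateField ℚ_[p] (PadicAlgCl p)) [FiniteDimensional ℚ_[p] E]
    (hE : residueDegree p E = Module.finrank ℚ_[p] E) :
    ∀ E' : IntermediateField ℚ_[p] (PadicAlgCl p), FiniteDimensional ℚ_[p] E' →
      Module.finrank ℚ_[p] E' = Module.finrank ℚ_[p] E → residueCardMLF p E' = residueCardMLF p E → E' = E := by
  intro E' hE' hdeg hq
  haveI : FiniteDimensional ℚ_[p] E' := hE'
  exact eq_of_unramified p E E' hE hdeg (residueDegree_eq_of_residueCardMLF_eq p E E' hq)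

/-- **An absolutely unramified `E ⊆ Q̄_p` is determined by its absolute Galois group: its anabelomorphs of finite
degree inside `Q̄_p` are exactly `{E}`** ([AbsAnab] Prop. 1.2.1 (v), F-0022: degree and residue cardinality are
amphoric — a theorem of the tree — + the uniqueness of the unramified extension of each degree, `eq_of_unramified`).
Hence Joshi's (Ind1) «consider all Fargues–Fontaine curves X with π₁^{et}(X) = G_{L_v}» ([J-III] p.92 l.18–23) ranges
over the SINGLE field `L_v` at every place `v` of `L` UNRAMIFIED over `ℚ` — all but finitely many places.
[cite: MochizukiAbsAnab2004, Prop 1.2.1 (v) p.10] -/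
theorem anabelomorphs_eq_singleton_of_unramified (E : IntermediateField ℚ_[p] (PadicAlgCl p))
    [FiniteDimensional ℚ_[p] E] (hE : residueDegree p E = Module.finrank ℚ_[p] E) :
    {E' : IntermediateField ℚ_[p] (PadicAlgCl p) | FiniteDimensional ℚ_[p] E' ∧ Anabelomorphic p E E'} = {E} :=
  anabelomorphs_eq_singleton_of_rigid p E (rigid_of_unramified p E hE)

/-- Pointwise form: a subfield of `Q̄_p` of finite degree anabelomorphic to an absolutely unramified `E` IS `E`.
[cite: MochizukiAbsAnab2004, Prop 1.2.1 (v) p.10] -/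
theorem eq_of_anabelomorphic_of_unramified (E E' : IntermediateField ℚ_[p] (PadicAlgCl p))
    [FiniteDimensional ℚ_[p] E] [hE' : FiniteDimensional ℚ_[p] E'] (hE : residueDegree p E = Module.finrank ℚ_[p] E)
    (h : Anabelomorphic p E E') : E' = E := by
  have hmem : E' ∈ {E' : IntermediateField ℚ_[p] (PadicAlgCl p) | FiniteDimensional ℚ_[p] E' ∧ Anabelomorphic p E E'} :=
    ⟨hE', h⟩
  rw [anabelomorphs_eq_singleton_of_unramified p E hE] at hmem
  exact hmem

/-- The same with unramifiedness in the form `e_E = 1` (`e·f = [E : ℚ_p]`, the tree's `absRamificationIdx_mul_residueDegree`).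
[cite: MochizukiAbsAnab2004, Prop 1.2.1 (v) p.10] -/
theorem anabelomorphs_eq_singleton_of_absRamificationIdx_eq_one (E : IntermediateField ℚ_[p] (PadicAlgCl p))
    [FiniteDimensional ℚ_[p] E] (he : absRamificationIdx p E = 1) :
    {E' : IntermediateField ℚ_[p] (PadicAlgCl p) | FiniteDimensional ℚ_[p] E' ∧ Anabelomorphic p E E'} = {E} := by
  refine anabelomorphs_eq_singleton_of_unramified p E ?_
  have h := absRamificationIdx_mul_residueDegree p E
  rw [he, one_mul] at h
  exact h

/-- Non-vacuity of the unramifiedness binder at degree `1`: `f_{ℚ_p} = [ℚ_p : ℚ_p] = 1` for `ℚ_p = ⊥ ⊆ Q̄_p`. [folklore] -/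
theorem residueDegree_bot_eq_finrank : residueDegree p (⊥ : IntermediateField ℚ_[p] (PadicAlgCl p)) =
    Module.finrank ℚ_[p] (⊥ : IntermediateField ℚ_[p] (PadicAlgCl p)) :=
  le_antisymm (residueDegree_le_finrank p _) (by rw [IntermediateField.finrank_bot]; exact residueDegree_pos p _)

end Unramified

/-! ## 3b. Bridge at an UNRAMIFIED place read on the real objects -/

namespace RosettaIndDatum

variable (𝔍 : RosettaIndDatum)

/-- **[J-III] §8.11.2's (Ind1) sentence, ∀-form, is FALSE AS TYPED at every datum with a place read on the real objects with
`L_v` absolutely UNRAMIFIED** (reading map `ι` into the subfields of `Q̄_p` of finite degree with `f = [ι(base v) : ℚ_p]`,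
`anab ⇒ Anabelomorphic`, same subfield ⇒ `fiso`): the Ind1-range at `v` is rigid. Every number field has all but finitely many
places unramified over `ℚ` (remark, not used). Not S-bearing; attach point A1 unchanged. [cite: MochizukiAbsAnab2004, Prop 1.2.1 (v) p.10] -/
theorem not_canonicalInd1_of_read_unramified {v : 𝔍.V} (p : ℕ) [Fact p.Prime]
    (ι : 𝔍.Fld v → IntermediateField ℚ_[p] (PadicAlgCl p)) (hfin : ∀ E', FiniteDimensional ℚ_[p] (ι E'))
    (hunr : residueDegree p (ι (𝔍.base v)) = Module.finrank ℚ_[p] (ι (𝔍.base v)))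
    (hanab : ∀ E', 𝔍.anab v (𝔍.base v) E' → Anabelomorphic p (ι (𝔍.base v)) (ι E'))
    (hfiso : ∀ E', ι E' = ι (𝔍.base v) → 𝔍.fiso v (𝔍.base v) E') :
    ¬ 𝔍.CanonicalInd1 := by
  haveI : FiniteDimensional ℚ_[p] (ι (𝔍.base v)) := hfin _
  exact 𝔍.not_canonicalInd1_of_read_rigid p ι hfin (rigid_of_unramified p (ι (𝔍.base v)) hunr) hanab hfiso

end RosettaIndDatum

end Summit.ABC.IUTFork.Joshi.ATS3

end
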